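import Summits.Ventures.PercRepro.C041CycleZone3
import Summits.Ventures.PercRepro.C041ConeClassF

/-!
# ROW C-041 — THE CLASS WITH MARKED TWO- AND THREE-EXIT CYCLES: `IsZf` extended by the three-exit cycles with
three marked vertices as further seeds (p6, gen 31)

`IsZg` is the class of zones generated from the members of `IsZf` (`C041ConeClassF`: the one-vertex zones and the
marked two-exit cycles, closed under hanging, anchor gluing and stray vertices) AND THE MARKED THREE-EXIT CYCLES —
every cycle `C_{n+1}` through the anchor carrying three marked vertices of any marks (`C041CycleZone3`:
`inCone_sixVec_cyc3_point`) — by the same four operations.  **Every member lies in the cone** (`IsZg.inCone`),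
hence satisfies (P), the one-anchor (CS) and the ZONE O-CUBE (`IsZg.K4_counts`, `IsZg.zoneCSConj`,
`IsZg.zoneOCubeConj`): a block–cut tree of marked points and marked two- and three-exit cycles, hung and glued in
any way, satisfies mine-3's CONJECTURE (ZONE O-CUBE).
-/

namespace PercRepro

namespace ZoneZ

open ZoneData TreeClosure RelaxedTriangle Finset TwoExit PointZone

/-- THE CLASS WITH MARKED TWO- AND THREE-EXIT CYCLES: the members of `IsZf` and the marked three-exit cycles,
closed under pendant attachment, anchor gluing and the addition or removal of stray vertices. -/
inductive IsZg : {V E T₁ T₂ : Type} → ZoneData V E T₁ T₂ → V → Prop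
  /-- every member of the class `IsZf` -/
  | ofZf {V E T₁ T₂ : Type} (Z : ZoneData V E T₁ T₂) (k : V) : IsZf Z k → IsZg Z k
  /-- the cycle `C_{n+1}` through the anchor with `p` / `q`, `p'` / `q'`, `p''` / `q''` marks at `x_i`, `x_j`,
  `x_k`, `0 < i < j < k` -/
  | cycle3 (n : ℕ) (i j k : Fin (n + 1)) (hi : 0 < i.val) (hij : i.val < j.val) (hjk : j.val < k.val)
      (p q p' q' p'' q'' : ℕ) :
      IsZg (cyc3 n i j k (pointZone p q) () (pointZone p' q') () (pointZone p'' q'') ())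
        (Sum.inl (Sum.inl (Sum.inl 0)))
  /-- a member hung at any vertex of any unmarked multigraph, anchored anywhere in the latter -/
  | pendant {V₁ E₁ U₁ U₂ V₂ E₂ T₁ T₂ : Type} (Z₁ : ZoneData V₁ E₁ U₁ U₂) (u a : V₁) (Z₂ : ZoneData V₂ E₂ T₁ T₂)
      (a₂ : V₂) : IsZg Z₂ a₂ → IsZg (Pendant.pendant Z₁ u Z₂ a₂) (Sum.inl a)
  /-- two members glued at their anchors -/
  | glue {V₂ E₂ S₁ S₂ V₃ E₃ R₁ R₂ : Type} (Z₂ : ZoneData V₂ E₂ S₁ S₂) (a₂ : V₂) (Z₃ : ZoneData V₃ E₃ R₁ R₂)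
      (a₃ : V₃) : IsZg Z₂ a₂ → IsZg Z₃ a₃ → IsZg (AnchorGlue.glue Z₂ a₂ Z₃ a₃) (Sum.inl a₂)
  /-- a member with stray vertices added (the target of an embedding) -/
  | embUp {V E T₁ T₂ V' E' T₁' T₂' : Type} {Z : ZoneData V E T₁ T₂} {Z' : ZoneData V' E' T₁' T₂'} (k : V)
      (φ : ZoneEmb Z Z') : IsZg Z k → IsZg Z' (φ.v k)
  /-- a member with stray vertices removed (the source of an embedding) -/
  | embDown {V E T₁ T₂ V' E' T₁' T₂' : Type} {Z : ZoneData V E T₁ T₂} {Z' : ZoneData V' E' T₁' T₂'} (k : V)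
      (φ : ZoneEmb Z Z') : IsZg Z' (φ.v k) → IsZg Z k

/-- An isomorphic copy of a member is a member. -/
theorem IsZg.iso {V E T₁ T₂ V' E' T₁' T₂' : Type} {Z : ZoneData V E T₁ T₂} {Z' : ZoneData V' E' T₁' T₂'} (k : V)
    (φ : ZoneIso Z Z') (h : IsZg Z k) : IsZg Z' (φ.v k) :=
  IsZg.embUp k (ZoneEmb.ofIso φ) h

/-- **THE SIX-VECTOR OF EVERY MEMBER LIES IN THE CONE**, for every choice of the finiteness instances. -/
theorem IsZg.inCone {V E T₁ T₂ : Type} {Z : ZoneData V E T₁ T₂} {k : V} (h : IsZg Z k) :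
    ∀ (iE : Fintype E) (dE : DecidableEq E) (i₁ : Fintype T₁) (d₁ : DecidableEq T₁) (i₂ : Fintype T₂)
      (d₂ : DecidableEq T₂), InCone (@sixVec V E T₁ T₂ Z k iE dE i₁ d₁ i₂ d₂) := by
  induction h with
  | ofZf Z k h =>
    intro iE dE i₁ d₁ i₂ d₂
    exact h.inCone iE dE i₁ d₁ i₂ d₂
  | cycle3 n i j k hi hij hjk p q p' q' p'' q'' =>
    intro iE dE i₁ d₁ i₂ d₂
    convert inCone_sixVec_cyc3_point n i j k hi hij hjk p q p' q' p'' q''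
  | @pendant V₁ E₁ U₁ U₂ V₂ E₂ T₁ T₂ Z₁ u a Z₂ a₂ _ ih =>
    intro iE dE i₁ d₁ i₂ d₂
    haveI : Finite (E₁ ⊕ E₂) := Finite.of_fintype _
    haveI hf₁ : Finite E₁ := Finite.of_injective (Sum.inl : E₁ → E₁ ⊕ E₂) Sum.inl_injective
    haveI hf₂ : Finite E₂ := Finite.of_injective (Sum.inr : E₂ → E₁ ⊕ E₂) Sum.inr_injective
    letI jE₁ : Fintype E₁ := Fintype.ofFinite E₁
    letI jE₂ : Fintype E₂ := Fintype.ofFinite E₂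
    letI eE₁ : DecidableEq E₁ := Classical.decEq E₁
    letI eE₂ : DecidableEq E₂ := Classical.decEq E₂
    cases Subsingleton.elim iE (@instFintypeSum E₁ E₂ jE₁ jE₂)
    cases Subsingleton.elim dE (@instDecidableEqSum E₁ E₂ eE₁ eE₂)
    exact Pendant.inCone_sixVec_pendant Z₁ u Z₂ a₂ a (ih jE₂ eE₂ i₁ d₁ i₂ d₂)
  | @glue V₂ E₂ S₁ S₂ V₃ E₃ R₁ R₂ Z₂ a₂ Z₃ a₃ _ _ ih₂ ih₃ =>
    intro iE dE i₁ d₁ i₂ d₂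
    haveI : Finite (E₂ ⊕ E₃) := Finite.of_fintype _
    haveI : Finite (S₁ ⊕ R₁) := Finite.of_fintype _
    haveI : Finite (S₂ ⊕ R₂) := Finite.of_fintype _
    haveI : Finite E₂ := Finite.of_injective (Sum.inl : E₂ → E₂ ⊕ E₃) Sum.inl_injective
    haveI : Finite E₃ := Finite.of_injective (Sum.inr : E₃ → E₂ ⊕ E₃) Sum.inr_injective
    haveI : Finite S₁ := Finite.of_injective (Sum.inl : S₁ → S₁ ⊕ R₁) Sum.inl_injective
    haveI : Finite R₁ := Finite.of_injective (Sum.inr : R₁ → S₁ ⊕ R₁) Sum.inr_injective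
    haveI : Finite S₂ := Finite.of_injective (Sum.inl : S₂ → S₂ ⊕ R₂) Sum.inl_injective
    haveI : Finite R₂ := Finite.of_injective (Sum.inr : R₂ → S₂ ⊕ R₂) Sum.inr_injective
    letI jE₂ : Fintype E₂ := Fintype.ofFinite E₂
    letI jE₃ : Fintype E₃ := Fintype.ofFinite E₃
    letI jS₁ : Fintype S₁ := Fintype.ofFinite S₁
    letI jR₁ : Fintype R₁ := Fintype.ofFinite R₁
    letI jS₂ : Fintype S₂ := Fintype.ofFinite S₂
    letI jR₂ : Fintype R₂ := Fintype.ofFinite R₂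
    letI eE₂ : DecidableEq E₂ := Classical.decEq E₂
    letI eE₃ : DecidableEq E₃ := Classical.decEq E₃
    letI eS₁ : DecidableEq S₁ := Classical.decEq S₁
    letI eR₁ : DecidableEq R₁ := Classical.decEq R₁
    letI eS₂ : DecidableEq S₂ := Classical.decEq S₂
    letI eR₂ : DecidableEq R₂ := Classical.decEq R₂
    cases Subsingleton.elim iE (@instFintypeSum E₂ E₃ jE₂ jE₃)
    cases Subsingleton.elim dE (@instDecidableEqSum E₂ E₃ eE₂ eE₃)
    cases Subsingleton.elim i₁ (@instFintypeSum S₁ R₁ jS₁ jR₁)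
    cases Subsingleton.elim d₁ (@instDecidableEqSum S₁ R₁ eS₁ eR₁)
    cases Subsingleton.elim i₂ (@instFintypeSum S₂ R₂ jS₂ jR₂)
    cases Subsingleton.elim d₂ (@instDecidableEqSum S₂ R₂ eS₂ eR₂)
    exact AnchorGlue.inCone_sixVec_glue Z₂ a₂ Z₃ a₃ (ih₂ jE₂ eE₂ jS₁ eS₁ jS₂ eS₂) (ih₃ jE₃ eE₃ jR₁ eR₁ jR₂ eR₂)
  | @embUp V E T₁ T₂ V' E' T₁' T₂' Z Z' k φ _ ih =>
    intro iE dE i₁ d₁ i₂ d₂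
    haveI : Finite E' := Finite.of_fintype _
    haveI : Finite T₁' := Finite.of_fintype _
    haveI : Finite T₂' := Finite.of_fintype _
    haveI : Finite E := Finite.of_injective φ.e φ.e.injective
    haveI : Finite T₁ := Finite.of_injective φ.t₁ φ.t₁.injective
    haveI : Finite T₂ := Finite.of_injective φ.t₂ φ.t₂.injective
    letI jE : Fintype E := Fintype.ofFinite E
    letI j₁ : Fintype T₁ := Fintype.ofFinite T₁
    letI j₂ : Fintype T₂ := Fintype.ofFinite T₂
    letI eE : DecidableEq E := Classical.decEq E
    letI e₁ : DecidableEq T₁ := Classical.decEq T₁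
    letI e₂ : DecidableEq T₂ := Classical.decEq T₂
    rw [ZoneEmb.sixVec_eq φ k]
    exact ih jE eE j₁ e₁ j₂ e₂
  | @embDown V E T₁ T₂ V' E' T₁' T₂' Z Z' k φ _ ih =>
    intro iE dE i₁ d₁ i₂ d₂
    haveI : Finite E := Finite.of_fintype _
    haveI : Finite T₁ := Finite.of_fintype _
    haveI : Finite T₂ := Finite.of_fintype _
    haveI : Finite E' := Finite.of_injective φ.e.symm φ.e.symm.injective
    haveI : Finite T₁' := Finite.of_injective φ.t₁.symm φ.t₁.symm.injective
    haveI : Finite T₂' := Finite.of_injective φ.t₂.symm φ.t₂.symm.injective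
    letI jE : Fintype E' := Fintype.ofFinite E'
    letI j₁ : Fintype T₁' := Fintype.ofFinite T₁'
    letI j₂ : Fintype T₂' := Fintype.ofFinite T₂'
    letI eE : DecidableEq E' := Classical.decEq E'
    letI e₁ : DecidableEq T₁' := Classical.decEq T₁'
    letI e₂ : DecidableEq T₂' := Classical.decEq T₂'
    rw [← ZoneEmb.sixVec_eq φ k]
    exact ih jE eE j₁ e₁ j₂ e₂

/-- **THE INVARIANT (P) ON THE CLASS.** -/
theorem IsZg.K4_counts {V E T₁ T₂ : Type} {Z : ZoneData V E T₁ T₂} {k : V} (h : IsZg Z k) [Fintype E]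
    [DecidableEq E] [Fintype T₁] [DecidableEq T₁] [Fintype T₂] [DecidableEq T₂] :
    K4 (#(Z.Fset k) : ℝ) (#(Z.T1set k)) (#(Z.T2set k)) (#(Z.Iset k)) :=
  Z.K4_of_inCone_sixVec k (h.inCone _ _ _ _ _ _)

/-- **THE ONE-ANCHOR (CS) ON THE CLASS.** -/
theorem IsZg.zoneCSConj {V E T₁ T₂ : Type} {Z : ZoneData V E T₁ T₂} {k : V} (h : IsZg Z k) [Fintype E]
    [DecidableEq E] [Fintype T₁] [DecidableEq T₁] [Fintype T₂] [DecidableEq T₂] :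
    Z.ZoneCSConj {k} (∅ : Set V) :=
  Z.zoneCSConj_of_inCone_sixVec k (h.inCone _ _ _ _ _ _)

/-- **THE ZONE O-CUBE ON THE CLASS WITH MARKED TWO- AND THREE-EXIT CYCLES** — mine-3's CONJECTURE (ZONE O-CUBE)
is a theorem on every zone generated from the one-vertex zones AND the cycles with two or three marked vertices by
hanging at vertices of unmarked multigraphs, gluing at the anchor, and adding or removing stray vertices. -/
theorem IsZg.zoneOCubeConj {V E T₁ T₂ : Type} {Z : ZoneData V E T₁ T₂} {k : V} (h : IsZg Z k) [Fintype E]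
    [DecidableEq E] [Fintype T₁] [DecidableEq T₁] [Fintype T₂] [DecidableEq T₂] :
    Z.ZoneOCubeConj {k} (∅ : Set V) :=
  Z.zoneOCubeConj_of_inCone_sixVec k (h.inCone _ _ _ _ _ _)

/-- **The cycle operation on the class, modulo the triangle**: for two members at the exits, every two-exit cycle
is in the cone — hence satisfies the ZONE O-CUBE — as soon as the triangle on the same two zones is in the cone
(mine-3's CONJECTURE (CONE) for the triangle is exactly the missing hypothesis). -/
theorem IsZg.inCone_cyc2_of_tri2 (n : ℕ) (i j : Fin (n + 1)) (hi : 0 < i.val) (hij : i.val < j.val)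
    {V E T₁ T₂ V' E' T₁' T₂' : Type} {Z : ZoneData V E T₁ T₂} {a : V} {Z' : ZoneData V' E' T₁' T₂'} {a' : V'}
    [Fintype E] [DecidableEq E] [Fintype T₁] [DecidableEq T₁] [Fintype T₂] [DecidableEq T₂] [Fintype E']
    [DecidableEq E'] [Fintype T₁'] [DecidableEq T₁'] [Fintype T₂'] [DecidableEq T₂'] (h : IsZg Z a)
    (h' : IsZg Z' a') (ht : InCone ((tri2 Z a Z' a').sixVec (Sum.inl (Sum.inl 0)))) :
    InCone ((cyc2 n i j Z a Z' a').sixVec (Sum.inl (Sum.inl 0))) :=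
  inCone_sixVec_cyc2_of_tri2 n i j Z a Z' a' hi hij (h.inCone _ _ _ _ _ _) (h'.inCone _ _ _ _ _ _) ht


/-- Three members whose square map is in the cone give cone membership of every three-exit cycle zone on them. -/
theorem IsZg.inCone_cyc3_of_square (n : ℕ) (i j k : Fin (n + 1)) (hi : 0 < i.val) (hij : i.val < j.val)
    (hjk : j.val < k.val) {V E T₁ T₂ V' E' T₁' T₂' V'' E'' T₁'' T₂'' : Type} (Z : ZoneData V E T₁ T₂) (a : V)
    (Z' : ZoneData V' E' T₁' T₂') (a' : V') (Z'' : ZoneData V'' E'' T₁'' T₂'') (a'' : V'') [Fintype E]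
    [DecidableEq E] [Fintype T₁] [DecidableEq T₁] [Fintype T₂] [DecidableEq T₂] [Fintype E'] [DecidableEq E']
    [Fintype T₁'] [DecidableEq T₁'] [Fintype T₂'] [DecidableEq T₂'] [Fintype E''] [DecidableEq E''] [Fintype T₁'']
    [DecidableEq T₁''] [Fintype T₂''] [DecidableEq T₂''] (h : IsZg Z a) (h' : IsZg Z' a') (h'' : IsZg Z'' a'')
    (hsq : InCone (square (Z.sixVec a) (Z'.sixVec a') (Z''.sixVec a''))) :
    InCone ((cyc3 n i j k Z a Z' a' Z'' a'').sixVec (Sum.inl (Sum.inl (Sum.inl 0)))) :=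
  inCone_sixVec_cyc3_of_square n i j k Z a Z' a' Z'' a'' hi hij hjk (h.inCone _ _ _ _ _ _) (h'.inCone _ _ _ _ _ _)
    (h''.inCone _ _ _ _ _ _) hsq

end ZoneZ

end PercRepro
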